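import Literature.Barriers.ValiantsHypothesis.CT23AnnihilatorAsDeterminant
import Literature.Computability.AlgebraicComplexity.ASSS16FaithfulHomomorphisms
import HarnessLib

/-!
# Kronecker evaluation points from a rank extractor: the rows of Lemma 3.2's matrix `M'`
# (Chatterjee–Tengse arXiv:2309.07612v2, Claim 3.3 and the end of the proof of Lemma 3.2 =
# v1 Claim 40 and p0015.txt:L36–L56; val-lit t18 g7, X-CT23 engine brick E-e, part D)

Theorem-only (plus plumbing `def`s) companion of `CT23AnnihilatorAsDeterminant.lean`; NO named
facts. Honest framing: the "explicit points" half of the source's Lemma 3.2; it discharges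
nothing by itself; `VP ≠ VNP` is NOT proved and nothing here bears on it.

## The printed step

Claim 3.3 (v1 Claim 40, p0014.txt:L78–L92): "Define for `α ∈ F`, the matrix
`E_α ∈ F^{(K−1) × R}` such that `E_α[i,j] = α^{ij}` … For some `α ≤ D^{2n}`, the matrix product
`M' := E_α · M` has rank exactly `K−1`" (by the rank extractor Lemma 2.8 [GR08, FS12]); and
(p0015.txt:L36–L56) "`M'` has a very special structure … `M'[i, e^{(j)}] = (G(v_{α,i}))^{e^{(j)}}`"
with the KRONECKER POINTS `v_{α,i} = (α^i, α^{i·(ndD)}, …, α^{i·(ndD)^{m−1}})`: multiplying the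
coefficient matrix of the column polynomials by `(α^{iℓ})` EVALUATES them at `v_{α,i}`.

## Rendering

* `kronPoint Δ β = (β^{Δ^0}, β^{Δ^1}, …)` and the Kronecker substitution identity
  `eval_kronPoint`: for `P` of individual degree `< Δ`, `P(kronPoint Δ β) = Σ_ℓ coeff_{digits ℓ}(P) β^ℓ`
  (`digits Δ ℓ` = base-`Δ` digits of `ℓ < Δ^m`, Mathlib's `finFunctionFinEquiv`).
* `exists_kronecker_det_eval_ne_zero`: for LINEARLY INDEPENDENT `P_0, …, P_{K−1}` of individual
  degree `< Δ` over a field of characteristic `0` there is `α` with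
  `det [P_j(kronPoint Δ (α^{i+1}))]_{i,j} ≠ 0` — via the tree's ASSS16 Cor. 7.2
  (`ASSS16.exists_forall_det_mul_powMatrix_ne_zero`, the `(α^{(i+1)(j+1)})` rank extractor; the
  exponent shift `i ↦ i+1` relative to the printed `α^{ij}` only rescales the rows by `α^{i+1}`).
* `exists_annihilator_eq_det_annMatrix_kronecker`: Lemma 3.2's determinant presentation
  (`CT23AnnihilatorAsDeterminant.exists_annihilator_eq_det_annMatrix`) WITH THE PRINTED KRONECKER
  ROWS: points `p_i = kronPoint Δ (α^{i+1})`, `Δ = n(D−1)d + 1`.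
  Deviation kept from parts A–C (disclosed): the column monomials are a maximal independent
  subfamily of the support of a dimension-count annihilator plus one more, not the source's
  lexicographically first dependent prefix; the bound `α ≤ D^{2n}` (an integer `α`) is not
  tracked — `α ∈ F` is what the explicit encoder (Lemma 3.5, a constant-free circuit computes `α`
  from `1`) will need in the integer form; recorded as a TODO for part E-e′.

## References

* [ChatterjeeTengse2023] P. Chatterjee, A. Tengse, *Lower Bounds from Succinct Hitting Sets*,
  arXiv:2309.07612v2, Lemma 3.2 / Claim 3.3 (v1: Lemma 39 / Claim 40; p0014.txt:L78–L92,
  p0015.txt:L36–L56); Lemma 2.8 (rank extractor, [GR08], [FS12]).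
* [AgrawalEtAl2011] M. Agrawal, C. Saha, R. Saptharishi, N. Saxena, *Jacobian hits circuits*
  (the tree's `ASSS16FaithfulHomomorphisms.lean`, Lemma 7.1 / Cor. 7.2).
-/

noncomputable section

open MvPolynomial Matrix

namespace Literature.Barriers.ValiantsHypothesis

open Literature.Computability.AlgebraicComplexity

universe u

variable {F : Type u} [Field F] {m : ℕ}

/-! ### Kronecker points and base-`Δ` digits -/

section Kronecker

/-- **The Kronecker point** `v = (β, β^Δ, β^{Δ²}, …, β^{Δ^{m−1}})` (the source's `v_{α,i}` is
`kronPoint (ndD) (α^i)`). [cite: ChatterjeeTengse2023, Lemma 3.2 (v1: Lemma 39; p0014.txt:L26, p0015.txt:L49)] -/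
def kronPoint (Δ : ℕ) (β : F) : Fin m → F := fun b => β ^ Δ ^ (b : ℕ)

/-- The base-`Δ` digits of `ℓ < Δ^m` as an exponent vector (the source's `v_ℓ`:
"`ℓ = Σ_b v_ℓ(b) · (ndD)^{b−1}`"). [cite: ChatterjeeTengse2023, proof of Lemma 3.2 (v1: p0015.txt:L38–L41)] -/
def digits (Δ : ℕ) (ℓ : Fin (Δ ^ m)) : Fin m →₀ ℕ :=
  Finsupp.equivFunOnFinite.symm fun b => (finFunctionFinEquiv.symm ℓ b : ℕ)

/-- The digits, coordinatewise. [cite: ChatterjeeTengse2023, proof of Lemma 3.2 (v1: p0015.txt:L38–L41)] -/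
@[simp] theorem digits_apply (Δ : ℕ) (ℓ : Fin (Δ ^ m)) (b : Fin m) :
    digits Δ ℓ b = (finFunctionFinEquiv.symm ℓ b : ℕ) := by
  simp [digits]

/-- Digits are `< Δ`. [cite: ChatterjeeTengse2023, proof of Lemma 3.2 (v1: p0015.txt:L38–L41)] -/
theorem digits_lt (Δ : ℕ) (ℓ : Fin (Δ ^ m)) (b : Fin m) : digits Δ ℓ b < Δ := by
  rw [digits_apply]; exact Fin.is_lt _

/-- `ℓ = Σ_b digits_b · Δ^b`. [cite: ChatterjeeTengse2023, proof of Lemma 3.2 (v1: p0015.txt:L38–L41)] -/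
theorem sum_digits_mul_pow (Δ : ℕ) (ℓ : Fin (Δ ^ m)) :
    ∑ b : Fin m, digits Δ ℓ b * Δ ^ (b : ℕ) = ℓ := by
  simp only [digits_apply]
  rw [← finFunctionFinEquiv_apply, Equiv.apply_symm_apply]

/-- Distinct indices have distinct digits. [cite: ChatterjeeTengse2023, proof of Lemma 3.2 (v1: p0015.txt:L38–L41)] -/
theorem digits_injective (Δ : ℕ) : Function.Injective (digits (m := m) Δ) := by
  intro ℓ ℓ' h
  have : ∀ b, finFunctionFinEquiv.symm ℓ b = finFunctionFinEquiv.symm ℓ' b := fun b =>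
    Fin.ext (by simpa using congrArg (fun d => d b) h)
  exact finFunctionFinEquiv.symm.injective (funext this)

/-- Every exponent vector in the box is the digit vector of some index.
[cite: ChatterjeeTengse2023, proof of Lemma 3.2 (v1: p0015.txt:L38–L41)] -/
theorem exists_digits_eq (Δ : ℕ) {d : Fin m →₀ ℕ} (hd : ∀ b, d b < Δ) :
    ∃ ℓ : Fin (Δ ^ m), digits Δ ℓ = d :=
  ⟨finFunctionFinEquiv fun b => ⟨d b, hd b⟩, by ext b; simp⟩

/-- **Kronecker substitution**: for `P` of individual degree `< Δ`,
`P(β, β^Δ, …, β^{Δ^{m−1}}) = Σ_{ℓ < Δ^m} coeff_{digits ℓ}(P) · β^ℓ` ("`M'[i,e^{(j)}] = Σ_ℓ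
coeff_{z^{v_ℓ}}(G^{e^{(j)}}) · α^{iℓ} = … = (G(v_{α,i}))^{e^{(j)}}`").
[cite: ChatterjeeTengse2023, proof of Lemma 3.2 (v1: p0015.txt:L42–L52)] -/
theorem eval_kronPoint (Δ : ℕ) (β : F) (P : MvPolynomial (Fin m) F)
    (hP : ∀ d ∈ P.support, ∀ b, d b < Δ) :
    eval (kronPoint Δ β) P = ∑ ℓ : Fin (Δ ^ m), coeff (digits Δ ℓ) P * β ^ (ℓ : ℕ) := by
  classical
  -- rewrite `β^ℓ` as the monomial `z^{digits ℓ}` at the Kronecker point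
  have hmon : ∀ ℓ : Fin (Δ ^ m), β ^ (ℓ : ℕ) = ∏ b : Fin m, kronPoint Δ β b ^ digits Δ ℓ b := by
    intro ℓ
    conv_lhs => rw [← sum_digits_mul_pow Δ ℓ]
    rw [← Finset.prod_pow_eq_pow_sum]
    refine Finset.prod_congr rfl fun b _ => ?_
    rw [kronPoint, ← pow_mul, mul_comm]
  simp_rw [hmon]
  -- both sides are sums of `coeff d P * z^d(point)` over `d`: support versus the whole box
  rw [eval_eq']
  rw [← Finset.sum_image (f := fun d : Fin m →₀ ℕ => coeff d P * ∏ b, kronPoint Δ β b ^ d b)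
    (s := Finset.univ) (g := digits Δ) (fun ℓ _ ℓ' _ h => digits_injective Δ h)]
  refine Finset.sum_subset (fun d hd => ?_) (fun d _ hd => ?_)
  · obtain ⟨ℓ, rfl⟩ := exists_digits_eq Δ (hP d hd)
    exact Finset.mem_image_of_mem _ (Finset.mem_univ _)
  · rw [notMem_support_iff.1 hd, zero_mul]

end Kronecker

/-! ### Good `α` from the rank extractor: the Kronecker evaluation matrix is nonsingular -/

section Extractor

variable {K : ℕ}

/-- The coefficient matrix of the column polynomials on the box (the source's `M`, transposed:
row `j` = coefficient vector of `P_j`). [cite: ChatterjeeTengse2023, proof of Lemma 3.2, matrix `M` (v1: p0014.txt:L44–L50)] -/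
def coeffMatrix (Δ : ℕ) (P : Fin K → MvPolynomial (Fin m) F) : Matrix (Fin K) (Fin (Δ ^ m)) F :=
  Matrix.of fun j ℓ => coeff (digits Δ ℓ) (P j)

/-- **`M · E_αᵀ` evaluates at Kronecker points**: `(coeffMatrix · (α^{(ℓ+1)(i+1)}))[j,i] =
α^{i+1} · P_j(kronPoint Δ (α^{i+1}))`. [cite: ChatterjeeTengse2023, proof of Lemma 3.2 (v1: p0015.txt:L42–L52)] -/
theorem coeffMatrix_mul_powMatrix_apply (Δ : ℕ) {P : Fin K → MvPolynomial (Fin m) F}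
    (hP : ∀ j, ∀ d ∈ (P j).support, ∀ b, d b < Δ) (α : F) (j : Fin K) (i : Fin K) :
    (coeffMatrix Δ P * Matrix.of (fun (ℓ : Fin (Δ ^ m)) (i : Fin K) =>
        α ^ (((ℓ : ℕ) + 1) * ((i : ℕ) + 1)))) j i =
      α ^ ((i : ℕ) + 1) * eval (kronPoint Δ (α ^ ((i : ℕ) + 1))) (P j) := by
  rw [eval_kronPoint Δ _ _ (hP j), Finset.mul_sum, Matrix.mul_apply]
  refine Finset.sum_congr rfl fun ℓ _ => ?_
  rw [coeffMatrix, Matrix.of_apply, Matrix.of_apply, ← pow_mul, mul_left_comm]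
  congr 1
  rw [← pow_add]
  congr 1
  ring

/-- The rows of the coefficient matrix of LINEARLY INDEPENDENT box polynomials are linearly
independent. [cite: ChatterjeeTengse2023, proof of Lemma 3.2 (v1: p0014.txt:L53–L60)] -/
theorem linearIndependent_coeffMatrix (Δ : ℕ) {P : Fin K → MvPolynomial (Fin m) F}
    (hPind : LinearIndependent F P) (hP : ∀ j, ∀ d ∈ (P j).support, ∀ b, d b < Δ) :
    LinearIndependent F (fun j => coeffMatrix Δ P j) := by
  classical
  rw [Fintype.linearIndependent_iff]
  intro g hg
  have hQ : ∑ j, g j • P j = 0 := by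
    refine MvPolynomial.ext _ _ fun d => ?_
    rw [coeff_zero, coeff_sum]
    simp_rw [coeff_smul, smul_eq_mul]
    by_cases hd : ∀ b, d b < Δ
    · obtain ⟨ℓ, rfl⟩ := exists_digits_eq Δ hd
      have := congrFun hg ℓ
      simpa [coeffMatrix, Finset.sum_apply, Pi.smul_apply] using this
    · refine Finset.sum_eq_zero fun j _ => ?_
      rw [notMem_support_iff.1 (fun h => hd (hP j d h)), mul_zero]
  exact (Fintype.linearIndependent_iff.1 hPind) g hQ

/-- **Claim 3.3 with Kronecker rows.** For linearly independent polynomials `P_0, …, P_{K−1}` of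
individual degree `< Δ` over a field of characteristic `0` there is `α` such that the evaluation
matrix at the Kronecker points `kronPoint Δ (α^{i+1})`, `i < K`, is nonsingular — the rank
extractor `(α^{(ℓ+1)(i+1)})` of the tree's ASSS16 Cor. 7.2 applied to the coefficient matrix.
[cite: ChatterjeeTengse2023, Claim 3.3 (v1: Claim 40; p0014.txt:L78–L92) and p0015.txt:L36–L56] -/
theorem exists_kronecker_det_eval_ne_zero [CharZero F] (Δ : ℕ) {P : Fin K → MvPolynomial (Fin m) F}
    (hPind : LinearIndependent F P) (hP : ∀ j, ∀ d ∈ (P j).support, ∀ b, d b < Δ) :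
    ∃ α : F, (Matrix.of fun (i : Fin K) (j : Fin K) =>
      eval (kronPoint Δ (α ^ ((i : ℕ) + 1))) (P j)).det ≠ 0 := by
  classical
  haveI : Infinite F := Infinite.of_injective _ (Nat.cast_injective (R := F))
  have hcard : ((1 * Δ ^ m * K ^ 2 : ℕ) : Cardinal) < Cardinal.mk F :=
    (Cardinal.natCast_lt_aleph0).trans_le (Cardinal.infinite_iff.1 inferInstance)
  obtain ⟨α, hα⟩ := ASSS16.exists_forall_det_mul_powMatrix_ne_zero (t := 1)
    (fun _ => coeffMatrix Δ P) (fun _ => linearIndependent_coeffMatrix Δ hPind hP) hcard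
  refine ⟨α, fun h0 => hα 0 ?_⟩
  -- the extractor product is the transposed evaluation matrix with columns scaled by `α^{i+1}`
  set E : Matrix (Fin K) (Fin K) F :=
    Matrix.of fun (i : Fin K) (j : Fin K) => eval (kronPoint Δ (α ^ ((i : ℕ) + 1))) (P j) with hE
  have hprod : coeffMatrix Δ P * Matrix.of (fun (ℓ : Fin (Δ ^ m)) (i : Fin K) =>
      α ^ (((ℓ : ℕ) + 1) * ((i : ℕ) + 1))) =
      E.transpose * Matrix.diagonal fun i : Fin K => α ^ ((i : ℕ) + 1) := by
    ext j i
    rw [coeffMatrix_mul_powMatrix_apply Δ hP, Matrix.mul_diagonal, Matrix.transpose_apply, hE,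
      Matrix.of_apply, mul_comm]
  rw [hprod, Matrix.det_mul, Matrix.det_transpose, h0, zero_mul]

end Extractor

/-! ### Lemma 3.2's determinant presentation with the printed Kronecker rows -/

section Assembly

variable {n : ℕ}

/-- Support of a product of powers of degree-`≤ d` polynomials lies in the box of side
`(Σ_t e_t) · d + 1`. [cite: ChatterjeeTengse2023, proof of Lemma 3.2 "an `m`-variate polynomial of individual degree at most `(n·(D−1))·d`" (v1: p0014.txt:L49–L50)] -/
theorem box_of_mem_support_prod_pow {d D : ℕ} (G : Fin n → MvPolynomial (Fin m) F)
    (hG : ∀ i, (G i).totalDegree ≤ d) {e : Fin n →₀ ℕ} (he : ∀ t, e t < D)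
    {c : Fin m →₀ ℕ} (hc : c ∈ (∏ t, G t ^ e t).support) (b : Fin m) :
    c b < n * (D - 1) * d + 1 := by
  have h1 : c b ≤ (∏ t, G t ^ e t).totalDegree :=
    (Finsupp.le_degree b c).trans (by
      rw [Finsupp.degree_apply]
      exact le_totalDegree hc)
  have h2 : (∏ t, G t ^ e t).totalDegree ≤ n * (D - 1) * d := by
    refine (totalDegree_finsetProd _ _).trans ?_
    calc ∑ t, (G t ^ e t).totalDegree ≤ ∑ _t : Fin n, (D - 1) * d :=
          Finset.sum_le_sum fun t _ => (totalDegree_pow _ _).trans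
            (Nat.mul_le_mul (Nat.le_sub_one_of_lt (he t)) (hG t))
      _ = n * (D - 1) * d := by simp [mul_assoc]
  omega

/-- **Lemma 3.2 (v1 Lemma 39) — the determinant presentation WITH KRONECKER ROWS.** As
`exists_annihilator_eq_det_annMatrix`, but the evaluation points are the printed
`v_{α,i} = kronPoint Δ (α^{i+1})`, `Δ = n(D−1)d + 1`, for one field element `α` (rank extractor).
[cite: ChatterjeeTengse2023, Lemma 3.2, Claims 3.3–3.4 (v1: Lemma 39, Claims 40–41; p0014.txt:L16–L92, p0015.txt:L1–L56)] -/
theorem exists_annihilator_eq_det_annMatrix_kronecker [CharZero F] {d D : ℕ}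
    (G : Fin n → MvPolynomial (Fin m) F) (hG : ∀ i, (G i).totalDegree ≤ d)
    (hD : (n * (D - 1) * d + 1) ^ m < D ^ n) :
    ∃ (K : ℕ) (e : Fin (K + 1) → (Fin n →₀ ℕ)) (α : F),
      Function.Injective e ∧ (∀ j t, e j t < D) ∧
      let p : Fin K → Fin m → F := fun i => kronPoint (n * (D - 1) * d + 1) (α ^ ((i : ℕ) + 1))
      (annMatrix (Matrix.of fun i j => eval (p i) (∏ t, G t ^ e j t)) e).det ≠ 0 ∧
      (∀ t, (annMatrix (Matrix.of fun i j => eval (p i) (∏ t, G t ^ e j t)) e).det.degreeOf t < D) ∧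
      aeval G (annMatrix (Matrix.of fun i j => eval (p i) (∏ t, G t ^ e j t)) e).det = 0 := by
  classical
  obtain ⟨A, hA0, hAdeg, hAG⟩ := exists_annihilator_degreeOf_lt G hG hD
  have hD0 : 0 < D := by
    rcases Nat.eq_zero_or_pos D with h | h
    · exfalso
      subst h
      rcases Nat.eq_zero_or_pos n with hn | hn
      · subst hn; simp at hD
      · exact Nat.not_lt_zero _ (hAdeg ⟨0, hn⟩)
    · exact h
  -- the column polynomials `G^e`, `e` in the support of `A`, are linearly dependent
  set S := A.support with hS
  set Pe : S → MvPolynomial (Fin m) F := fun e => ∏ t, G t ^ (e : Fin n →₀ ℕ) t with hPe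
  have hPe_mon : ∀ e : Fin n →₀ ℕ, aeval G (monomial e (1 : F)) = ∏ t, G t ^ e t := fun e => by
    rw [aeval_monomial, map_one, one_mul, Finsupp.prod_pow]
  have hdep : ¬ LinearIndependent F Pe := by
    rw [Fintype.not_linearIndependent_iff]
    refine ⟨fun e => coeff (e : Fin n →₀ ℕ) A, ?_, ?_⟩
    · have hmon : ∀ e : Fin n →₀ ℕ, aeval G (monomial e (coeff e A)) = coeff e A • ∏ t, G t ^ e t :=
        fun e => by
          rw [← hPe_mon, ← map_smul, smul_monomial, smul_eq_mul, mul_one]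
      calc ∑ e : S, coeff (e : Fin n →₀ ℕ) A • Pe e
          = ∑ e ∈ S, coeff e A • ∏ t, G t ^ e t :=
            Finset.sum_coe_sort S (fun e => coeff e A • ∏ t, G t ^ e t)
        _ = ∑ e ∈ S, aeval G (monomial e (coeff e A)) :=
            Finset.sum_congr rfl fun e _ => (hmon e).symm
        _ = aeval G A := by rw [← map_sum]; exact congrArg _ A.as_sum.symm
        _ = 0 := hAG
    · obtain ⟨e, he⟩ := MvPolynomial.ne_zero_iff.1 hA0
      exact ⟨⟨e, mem_support_iff.2 he⟩, he⟩
  obtain ⟨s, hs, hmax⟩ := exists_maximal_linearIndepOn F Pe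
  have hsfin : s.Finite := Set.toFinite s
  obtain ⟨estar, hestar⟩ : ∃ e, e ∉ s := by
    by_contra h
    have : s = Set.univ := Set.eq_univ_of_forall fun x => not_not.1 (not_exists.1 h x)
    subst this
    exact hdep (linearIndepOn_univ_iff.1 hs)
  obtain ⟨a, ha0, ha⟩ := hmax estar hestar
  set K := hsfin.toFinset.card with hK
  let enum : Fin K ≃ hsfin.toFinset := (hsfin.toFinset.equivFin).symm
  let e : Fin (K + 1) → (Fin n →₀ ℕ) :=
    Fin.snoc (fun j => ((enum j : S) : Fin n →₀ ℕ)) (estar : Fin n →₀ ℕ)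
  have he_cast : ∀ j : Fin K, e (Fin.castSucc j) = ((enum j : S) : Fin n →₀ ℕ) := fun j => by
    simp [e]
  have he_last : e (Fin.last K) = (estar : Fin n →₀ ℕ) := by simp [e]
  have hmemS : ∀ j, e j ∈ S := fun j => by
    induction j using Fin.lastCases with
    | last => rw [he_last]; exact estar.2
    | cast j => rw [he_cast]; exact (enum j : S).2
  have henum_mem : ∀ j : Fin K, ((enum j : hsfin.toFinset) : S) ∈ s := fun j => by
    have := (enum j).2
    simpa [Set.Finite.mem_toFinset] using this
  have hcast_ne_last : ∀ j : Fin K, e (Fin.castSucc j) ≠ e (Fin.last K) := fun j h => by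
    rw [he_last, he_cast] at h
    have : ((enum j : hsfin.toFinset) : S) = estar := Subtype.ext h
    exact hestar (this ▸ henum_mem j)
  have he_inj : Function.Injective e := by
    intro j₁ j₂ h
    induction j₁ using Fin.lastCases with
    | last =>
      induction j₂ using Fin.lastCases with
      | last => rfl
      | cast j₂ => exact absurd h.symm (hcast_ne_last j₂)
    | cast j₁ =>
      induction j₂ using Fin.lastCases with
      | last => exact absurd h (hcast_ne_last j₁)
      | cast j₂ =>
        rw [he_cast, he_cast] at h
        have : enum j₁ = enum j₂ := Subtype.ext (Subtype.ext h)
        rw [Fin.castSucc_inj]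
        exact enum.injective this
  have he_lt : ∀ j t, e j t < D := fun j t =>
    Nat.lt_of_le_of_lt (monomial_le_degreeOf t (hmemS j)) (hAdeg t)
  set P : Fin (K + 1) → MvPolynomial (Fin m) F := fun j => ∏ t, G t ^ e j t with hP
  have hPind : LinearIndependent F (P ∘ Fin.castSucc) := by
    have h1 : LinearIndependent F (fun x : s => Pe x) := hs
    have h2 : (P ∘ Fin.castSucc) = (fun x : s => Pe x) ∘ (fun j => ⟨_, henum_mem j⟩) := by
      funext j; simp [hP, hPe, he_cast]
    rw [h2]
    refine h1.comp _ fun j₁ j₂ h => ?_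
    have h' : ((enum j₁ : hsfin.toFinset) : S) = ((enum j₂ : hsfin.toFinset) : S) :=
      congrArg (fun x : s => (x : S)) h
    exact enum.injective (Subtype.ext h')
  have hPlast : P (Fin.last K) ∈ Submodule.span F (Set.range (P ∘ Fin.castSucc)) := by
    have hrange : Set.range (P ∘ Fin.castSucc) = Pe '' s := by
      ext y
      simp only [Set.mem_range, Function.comp_apply, Set.mem_image]
      constructor
      · rintro ⟨j, rfl⟩
        exact ⟨_, henum_mem j, by simp [hP, hPe, he_cast]⟩
      · rintro ⟨x, hx, rfl⟩
        refine ⟨enum.symm ⟨x, by simpa [Set.Finite.mem_toFinset] using hx⟩, ?_⟩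
        simp [hP, hPe, he_cast]
    rw [hrange]
    have hsm := Submodule.smul_mem _ a⁻¹ ha
    rw [smul_smul, inv_mul_cancel₀ ha0, one_smul] at hsm
    simpa [hP, hPe, he_last] using hsm
  obtain ⟨c, hc⟩ := (Submodule.mem_span_range_iff_exists_fun F).1 hPlast
  -- KRONECKER points for the independent prefix (part D)
  have hbox : ∀ j, ∀ c ∈ ((P ∘ Fin.castSucc) j).support, ∀ b, c b < n * (D - 1) * d + 1 :=
    fun j c hc b => box_of_mem_support_prod_pow G hG (he_lt _) hc b
  obtain ⟨α, hα⟩ := exists_kronecker_det_eval_ne_zero (n * (D - 1) * d + 1) hPind hbox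
  refine ⟨K, e, α, he_inj, he_lt, ?_, ?_, ?_⟩
  · refine det_annMatrix_ne_zero _ he_inj (j₀ := Fin.last K) ?_
    have : (Matrix.of fun (i : Fin K) j => eval (kronPoint (n * (D - 1) * d + 1) (α ^ ((i : ℕ) + 1)))
        (∏ t, G t ^ e j t)).submatrix id (Fin.last K).succAbove =
        Matrix.of fun (i : Fin K) (j : Fin K) =>
          eval (kronPoint (n * (D - 1) * d + 1) (α ^ ((i : ℕ) + 1))) ((P ∘ Fin.castSucc) j) := by
      ext i j; simp [hP, Fin.succAbove_last]
    rw [this]; exact hα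
  · exact degreeOf_det_annMatrix_lt _ hD0 he_lt
  · refine map_det_annMatrix_eq_zero _ e (P := P) (aeval G) (fun j => hPe_mon (e j))
      (p := fun i => kronPoint (n * (D - 1) * d + 1) (α ^ ((i : ℕ) + 1))) (fun i j => rfl)
      (f := Fin.snoc c (-1)) ?_ (j₀ := Fin.last K) (by simp)
    rw [Fin.sum_univ_castSucc]
    simp only [Fin.snoc_castSucc, Fin.snoc_last, neg_smul, one_smul]
    rw [show (∑ i : Fin K, c i • P (Fin.castSucc i)) = P (Fin.last K) from hc, add_neg_cancel]

end Assembly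

end Literature.Barriers.ValiantsHypothesis
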